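import Literature.NumberTheory.CubicFields.CubicFieldDiscriminant4087
import HarnessLib

/-!
# The cubic field of discriminant `−4087`, II: the primes above `2`, `3`, `5` are principal — `2 = 𝔭_a𝔭_b𝔭_c` (Dedekind's splitting, three prime elements of norm `±2`),
# `3 = 𝔭₁𝔭₂` (degrees `1`, `2`, both principal: `9 ≤ 18`), `5 = 𝔭₁𝔭₂'` (degree-one factor `(1 + 2θ + 2δ)`), all with explicit generators on `1, θ, δ`

Sequel of `CubicFieldDiscriminant4087.lean` (att-p4 g47, cell `bsd-f1-sign2`; template = att-p4 g46's `CubicFieldDiscriminant7255Primes`).  THEOREMS ONLY.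
Dedekind–Kummer through `θ` (`p ∤ 2 ⊇ [𝓞_F : ℤ[θ]]`) for `3`, `5`; the dyadic primes by the norm form.  The fundamental unit of `F` has logarithmic height `≈ 32.4`,
which is why the generators found by the weighted-LLL scan have up to five digits.  [cite: Marcus2018, Ch. 3, Thm. 27 and Exercise 21] [cite: LMFDB, number field 3.1.4087.1]
-/

noncomputable section

open Polynomial NumberField NumberField.InfinitePlace Ideal Module Real
open Literature.NumberTheory.NumberFields
open Literature.NumberTheory.NumberFields.MonicCubic

namespace Literature.NumberTheory.CubicFields.CubicDisc4087

section NumberField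

variable {F : Type*} [Field F] [NumberField F] {α : F}

/-! ## §3 The primes of norm `≤ 18` are principal: `p ≤ 5` -/

/-- `N(1 + 3 * θ - δ) = -2` (norm form on `1, α, α²`; `δ = (α ^ 2 + α) / 2`). [cite: Marcus2018, Ch. 2, Thm. 4 and Exercise 13] -/
theorem natAbs_norm_piA (h3 : finrank ℚ F = 3) (hα : aeval α (poly (-7) 18 8) = 0) :
    (Algebra.norm ℤ (1 + 3 * thetaInt hα - thetaInt (delta_root hα) : 𝓞 F)).natAbs = 2 := by
  have h : ((Algebra.norm ℤ (1 + 3 * thetaInt hα - thetaInt (delta_root hα) : 𝓞 F) : ℤ) : ℚ) = Algebra.norm ℚ (algebraMap (𝓞 F) F (1 + 3 * thetaInt hα - thetaInt (delta_root hα))) :=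
    Algebra.coe_norm_int _
  have hx : algebraMap (𝓞 F) F (1 + 3 * thetaInt hα - thetaInt (delta_root hα)) = ((1 : ℚ) : F) + ((5/2 : ℚ) : F) * α + ((-1/2 : ℚ) : F) * α ^ 2 := by
    simp only [map_mul, map_add, map_sub, map_ofNat, map_one, MonicCubic.thetaInt, RingOfIntegers.map_mk]
    push_cast; ring
  rw [hx, norm_lin irreducible_polyQ hα h3] at h
  have hn : normForm (-7) 18 8 (1) (5/2) (-1/2) = ((-2 : ℤ) : ℚ) := by norm_num [normForm]
  rw [hn] at h
  have h' : Algebra.norm ℤ (1 + 3 * thetaInt hα - thetaInt (delta_root hα) : 𝓞 F) = -2 := by exact_mod_cast h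
  rw [h']; rfl

/-- `1 + 3 * θ - δ` is a prime element of `𝓞_F` (norm `-2`). [cite: Marcus2018, Ch. 3, Thm. 27] -/
theorem prime_piA (h3 : finrank ℚ F = 3) (hα : aeval α (poly (-7) 18 8) = 0) : Prime (1 + 3 * thetaInt hα - thetaInt (delta_root hα) : 𝓞 F) :=
  prime_of_natAbs_norm_prime (by rw [natAbs_norm_piA h3 hα]; norm_num)

/-- `N(-33 - 65 * θ - 68 * δ) = 2` (norm form on `1, α, α²`; `δ = (α ^ 2 + α) / 2`). [cite: Marcus2018, Ch. 2, Thm. 4 and Exercise 13] -/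
theorem natAbs_norm_piB (h3 : finrank ℚ F = 3) (hα : aeval α (poly (-7) 18 8) = 0) :
    (Algebra.norm ℤ (-33 - 65 * thetaInt hα - 68 * thetaInt (delta_root hα) : 𝓞 F)).natAbs = 2 := by
  have h : ((Algebra.norm ℤ (-33 - 65 * thetaInt hα - 68 * thetaInt (delta_root hα) : 𝓞 F) : ℤ) : ℚ) = Algebra.norm ℚ (algebraMap (𝓞 F) F (-33 - 65 * thetaInt hα - 68 * thetaInt (delta_root hα))) :=
    Algebra.coe_norm_int _
  have hx : algebraMap (𝓞 F) F (-33 - 65 * thetaInt hα - 68 * thetaInt (delta_root hα)) = ((-33 : ℚ) : F) + ((-99 : ℚ) : F) * α + ((-34 : ℚ) : F) * α ^ 2 := by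
    simp only [map_mul, map_sub, map_neg, map_ofNat, MonicCubic.thetaInt, RingOfIntegers.map_mk]
    push_cast; ring
  rw [hx, norm_lin irreducible_polyQ hα h3] at h
  have hn : normForm (-7) 18 8 (-33) (-99) (-34) = ((2 : ℤ) : ℚ) := by norm_num [normForm]
  rw [hn] at h
  have h' : Algebra.norm ℤ (-33 - 65 * thetaInt hα - 68 * thetaInt (delta_root hα) : 𝓞 F) = 2 := by exact_mod_cast h
  rw [h']; rfl

/-- `-33 - 65 * θ - 68 * δ` is a prime element of `𝓞_F` (norm `2`). [cite: Marcus2018, Ch. 3, Thm. 27] -/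
theorem prime_piB (h3 : finrank ℚ F = 3) (hα : aeval α (poly (-7) 18 8) = 0) : Prime (-33 - 65 * thetaInt hα - 68 * thetaInt (delta_root hα) : 𝓞 F) :=
  prime_of_natAbs_norm_prime (by rw [natAbs_norm_piB h3 hα]; norm_num)

/-- `N(136 + 458 * θ - 337 * δ) = -2` (norm form on `1, α, α²`; `δ = (α ^ 2 + α) / 2`). [cite: Marcus2018, Ch. 2, Thm. 4 and Exercise 13] -/
theorem natAbs_norm_piC (h3 : finrank ℚ F = 3) (hα : aeval α (poly (-7) 18 8) = 0) :
    (Algebra.norm ℤ (136 + 458 * thetaInt hα - 337 * thetaInt (delta_root hα) : 𝓞 F)).natAbs = 2 := by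
  have h : ((Algebra.norm ℤ (136 + 458 * thetaInt hα - 337 * thetaInt (delta_root hα) : 𝓞 F) : ℤ) : ℚ) = Algebra.norm ℚ (algebraMap (𝓞 F) F (136 + 458 * thetaInt hα - 337 * thetaInt (delta_root hα))) :=
    Algebra.coe_norm_int _
  have hx : algebraMap (𝓞 F) F (136 + 458 * thetaInt hα - 337 * thetaInt (delta_root hα)) = ((136 : ℚ) : F) + ((579/2 : ℚ) : F) * α + ((-337/2 : ℚ) : F) * α ^ 2 := by
    simp only [map_mul, map_add, map_sub, map_ofNat, MonicCubic.thetaInt, RingOfIntegers.map_mk]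
    push_cast; ring
  rw [hx, norm_lin irreducible_polyQ hα h3] at h
  have hn : normForm (-7) 18 8 (136) (579/2) (-337/2) = ((-2 : ℤ) : ℚ) := by norm_num [normForm]
  rw [hn] at h
  have h' : Algebra.norm ℤ (136 + 458 * thetaInt hα - 337 * thetaInt (delta_root hα) : 𝓞 F) = -2 := by exact_mod_cast h
  rw [h']; rfl

/-- `136 + 458 * θ - 337 * δ` is a prime element of `𝓞_F` (norm `-2`). [cite: Marcus2018, Ch. 3, Thm. 27] -/
theorem prime_piC (h3 : finrank ℚ F = 3) (hα : aeval α (poly (-7) 18 8) = 0) : Prime (136 + 458 * thetaInt hα - 337 * thetaInt (delta_root hα) : 𝓞 F) :=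
  prime_of_natAbs_norm_prime (by rw [natAbs_norm_piC h3 hα]; norm_num)

/-- **`2` splits completely**: `(1 + 3 * θ - δ)·(-33 - 65 * θ - 68 * δ)·(136 + 458 * θ - 337 * δ) = (-1226625 - 3717338 * θ + 1697040 * δ)·2` (the cofactor is a unit). [cite: Marcus2018, Ch. 3, Thm. 27 and Exercise 21 (Dedekind)] -/
theorem prod_dyadic_eq (hα : aeval α (poly (-7) 18 8) = 0) :
    (1 + 3 * thetaInt hα - thetaInt (delta_root hα) : 𝓞 F) * (-33 - 65 * thetaInt hα - 68 * thetaInt (delta_root hα)) * (136 + 458 * thetaInt hα - 337 * thetaInt (delta_root hα)) = (-1226625 - 3717338 * thetaInt hα + 1697040 * thetaInt (delta_root hα)) * (((2 : ℕ) : ℤ) : 𝓞 F) := by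
  rw [RingOfIntegers.ext_iff]
  simp only [map_mul, map_add, map_sub, map_neg, map_ofNat, map_one, map_intCast, MonicCubic.thetaInt, RingOfIntegers.map_mk]
  push_cast
  linear_combination (((1224381 : F) / 4) + ((48421 : F) / 2) * α + ((-36593 : F) / 4) * α ^ 2 + ((-5729 : F) / 2) * α ^ 3) * cubic_eq hα

/-- **Every prime of `𝓞_F` above `2` is principal**: `2` is the product of the three prime elements above (up to a unit), so a prime `P ∋ 2` is one of
the three principal primes `(π)`. [cite: Marcus2018, Ch. 3, Thm. 27 and Exercise 21] [cite: LMFDB, number field 3.1.4087.1 (class number 1)] -/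
theorem isPrincipal_of_mem_primesOver_2 (h3 : finrank ℚ F = 3) (hα : aeval α (poly (-7) 18 8) = 0) {P : Ideal (𝓞 F)}
    (hP : P ∈ primesOver (span {((2 : ℕ) : ℤ)}) (𝓞 F)) : Submodule.IsPrincipal P := by
  haveI := hP.1
  have h2 : (((2 : ℕ) : ℤ) : 𝓞 F) ∈ P := by
    have hu : ((2 : ℕ) : ℤ) ∈ P.under ℤ := by
      rw [← hP.2.over]; exact Ideal.mem_span_singleton_self _
    exact hu
  have hmem : (1 + 3 * thetaInt hα - thetaInt (delta_root hα) : 𝓞 F) * (-33 - 65 * thetaInt hα - 68 * thetaInt (delta_root hα)) * (136 + 458 * thetaInt hα - 337 * thetaInt (delta_root hα)) ∈ P := by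
    rw [prod_dyadic_eq hα]; exact P.mul_mem_left _ h2
  rcases eq_span_singleton_of_prod_mem hP.1 (prime_piA h3 hα) (prime_piB h3 hα) (prime_piC h3 hα) hmem with h | h | h
  · exact ⟨⟨_, by rw [h, Ideal.submodule_span_eq]⟩⟩
  · exact ⟨⟨_, by rw [h, Ideal.submodule_span_eq]⟩⟩
  · exact ⟨⟨_, by rw [h, Ideal.submodule_span_eq]⟩⟩

/-- `(3, θ + 1) = (-29 - 86 * θ + 34 * δ)`, an element of norm `-3` (identities checked in `F`, `δ = (α ^ 2 + α) / 2`).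
[cite: Marcus2018, Ch. 3, Thm. 27] -/
theorem span_3_lin1_eq (hα : aeval α (poly (-7) 18 8) = 0) :
    span {(3 : 𝓞 F), thetaInt hα + 1} = span {-29 - 86 * thetaInt hα + 34 * thetaInt (delta_root hα)} := by
  apply le_antisymm
  · rw [span_le]
    rintro x hx
    rcases hx with rfl | hx
    · exact mem_span_singleton'.mpr ⟨-46775 + 18822 * thetaInt hα - 4490 * thetaInt (delta_root hα), by
          rw [RingOfIntegers.ext_iff]
          simp only [map_mul, map_add, map_sub, map_neg, map_ofNat, MonicCubic.thetaInt, RingOfIntegers.map_mk]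
          linear_combination (((169559 : F)) + ((-38165 : F)) * α) * cubic_eq hα⟩
    · rw [Set.mem_singleton_iff.mp hx]
      exact mem_span_singleton'.mpr ⟨-9605 + 3865 * thetaInt hα - 922 * thetaInt (delta_root hα), by
          rw [RingOfIntegers.ext_iff]
          simp only [map_mul, map_add, map_sub, map_neg, map_ofNat, map_one, MonicCubic.thetaInt, RingOfIntegers.map_mk]
          linear_combination (((34818 : F)) + ((-7837 : F)) * α) * cubic_eq hα⟩
  · rw [span_singleton_le_iff_mem, mem_span_pair]
    exact ⟨-19 * thetaInt hα + 34 * thetaInt (delta_root hα), -29 - 34 * thetaInt hα, by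
        rw [RingOfIntegers.ext_iff]
        simp only [map_mul, map_add, map_sub, map_neg, map_ofNat, map_one, MonicCubic.thetaInt, RingOfIntegers.map_mk]
        linear_combination (0 : F) * cubic_eq hα⟩

/-- `(3, θ ^ 2 + θ + 2) = (-46775 + 18822 * θ - 4490 * δ)`, an element of norm `-9` (identities checked in `F`, `δ = (α ^ 2 + α) / 2`).
[cite: Marcus2018, Ch. 3, Thm. 27] -/
theorem span_3_quad_eq (hα : aeval α (poly (-7) 18 8) = 0) :
    span {(3 : 𝓞 F), thetaInt hα ^ 2 + thetaInt hα + 2} = span {-46775 + 18822 * thetaInt hα - 4490 * thetaInt (delta_root hα)} := by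
  apply le_antisymm
  · rw [span_le]
    rintro x hx
    rcases hx with rfl | hx
    · exact mem_span_singleton'.mpr ⟨-29 - 86 * thetaInt hα + 34 * thetaInt (delta_root hα), by
          rw [RingOfIntegers.ext_iff]
          simp only [map_mul, map_add, map_sub, map_neg, map_ofNat, MonicCubic.thetaInt, RingOfIntegers.map_mk]
          linear_combination (((169559 : F)) + ((-38165 : F)) * α) * cubic_eq hα⟩
    · rw [Set.mem_singleton_iff.mp hx]
      exact mem_span_singleton'.mpr ⟨-198 - 536 * thetaInt hα + 66 * thetaInt (delta_root hα), by
          rw [RingOfIntegers.ext_iff]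
          simp only [map_mul, map_add, map_sub, map_neg, map_pow, map_ofNat, MonicCubic.thetaInt, RingOfIntegers.map_mk]
          linear_combination (((1157681 : F)) + ((-74085 : F)) * α) * cubic_eq hα⟩
  · rw [span_singleton_le_iff_mem, mem_span_pair]
    exact ⟨-46775 + 6274 * thetaInt hα - 32680 * thetaInt (delta_root hα), 46775, by
        rw [RingOfIntegers.ext_iff]
        simp only [map_mul, map_add, map_sub, map_neg, map_pow, map_ofNat, MonicCubic.thetaInt, RingOfIntegers.map_mk]
        linear_combination (0 : F) * cubic_eq hα⟩

/-- **Every prime of `𝓞_F` above `3` is principal** (Dedekind–Kummer through `θ`, `3 ∤ exponent`, with `polyMod_3` and the generators above).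
[cite: Marcus2018, Ch. 3, Thm. 27] [cite: LMFDB, number field 3.1.4087.1 (class number 1)] -/
theorem isPrincipal_of_mem_primesOver_3 (h3 : finrank ℚ F = 3) (hα : aeval α (poly (-7) 18 8) = 0) {P : Ideal (𝓞 F)}
    (hP : P ∈ primesOver (span {((3 : ℕ) : ℤ)}) (𝓞 F)) : Submodule.IsPrincipal P := by
  haveI : Fact (Nat.Prime 3) := ⟨by norm_num⟩
  obtain ⟨Qb, hirr, hmon, hdvd, -, hspan⟩ :=
    exists_factor_of_mem_primesOver' irreducible_polyQ hα (by norm_num : Nat.Prime 3)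
      (not_dvd_exponent h3 hα (by norm_num) (by norm_num)) hP
  rw [polyMod_3] at hdvd
  rcases hirr.prime.dvd_or_dvd hdvd with h | h
  · have hirr1 : Irreducible (X + 1 : (ZMod 3)[X]) := by
      rw [show (X + 1 : (ZMod 3)[X]) = X - C (-1) by rw [map_neg, map_one, sub_neg_eq_add]]
      exact irreducible_X_sub_C _
    have hQb : Qb = X + 1 := eq_of_monic_of_associated hmon (by monicity!) (hirr.associated_of_dvd hirr1 h)
    have hPeq := hspan (X + 1) (by rw [hQb]; simp)
    rw [show aeval (thetaInt hα) (X + 1 : ℤ[X]) = thetaInt hα + 1 by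
        simp only [map_add, aeval_X, map_one], Nat.cast_ofNat, span_3_lin1_eq hα] at hPeq
    exact ⟨⟨-29 - 86 * thetaInt hα + 34 * thetaInt (delta_root hα), by rw [hPeq, Ideal.submodule_span_eq]⟩⟩
  · have hQb : Qb = X ^ 2 + X + 2 :=
      eq_of_monic_of_associated hmon (by monicity!) (hirr.associated_of_dvd irreducible_quad_3 h)
    have hPeq := hspan (X ^ 2 + X + 2) (by rw [hQb]; simp)
    rw [show aeval (thetaInt hα) (X ^ 2 + X + 2 : ℤ[X]) = thetaInt hα ^ 2 + thetaInt hα + 2 by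
        simp only [map_add, map_pow, aeval_X, map_ofNat], Nat.cast_ofNat, span_3_quad_eq hα] at hPeq
    exact ⟨⟨-46775 + 18822 * thetaInt hα - 4490 * thetaInt (delta_root hα), by rw [hPeq, Ideal.submodule_span_eq]⟩⟩

/-- `(5, θ + 4) = (1 + 2 * θ + 2 * δ)`, an element of norm `-5` (identities checked in `F`, `δ = (α ^ 2 + α) / 2`).
[cite: Marcus2018, Ch. 3, Thm. 27] -/
theorem span_5_lin4_eq (hα : aeval α (poly (-7) 18 8) = 0) :
    span {(5 : 𝓞 F), thetaInt hα + 4} = span {1 + 2 * thetaInt hα + 2 * thetaInt (delta_root hα)} := by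
  apply le_antisymm
  · rw [span_le]
    rintro x hx
    rcases hx with rfl | hx
    · exact mem_span_singleton'.mpr ⟨-979 + 394 * thetaInt hα - 94 * thetaInt (delta_root hα), by
          rw [RingOfIntegers.ext_iff]
          simp only [map_mul, map_add, map_sub, map_neg, map_ofNat, map_one, MonicCubic.thetaInt, RingOfIntegers.map_mk]
          linear_combination (((-123 : F)) + ((-47 : F)) * α) * cubic_eq hα⟩
    · rw [Set.mem_singleton_iff.mp hx]
      exact mem_span_singleton'.mpr ⟨-708 + 285 * thetaInt hα - 68 * thetaInt (delta_root hα), by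
          rw [RingOfIntegers.ext_iff]
          simp only [map_mul, map_add, map_sub, map_neg, map_ofNat, map_one, MonicCubic.thetaInt, RingOfIntegers.map_mk]
          linear_combination (((-89 : F)) + ((-34 : F)) * α) * cubic_eq hα⟩
  · rw [span_singleton_le_iff_mem, mem_span_pair]
    exact ⟨1 - 3 * thetaInt hα - 2 * thetaInt (delta_root hα), -1 + 6 * thetaInt hα, by
        rw [RingOfIntegers.ext_iff]
        simp only [map_mul, map_add, map_sub, map_neg, map_ofNat, map_one, MonicCubic.thetaInt, RingOfIntegers.map_mk]
        linear_combination (0 : F) * cubic_eq hα⟩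

/-- **Every prime of `𝓞_F` above `5` with `5^f ≤ 18` is principal** (Dedekind–Kummer through `θ`, `5 ∤ exponent`, with `polyMod_5` and the generators above).
[cite: Marcus2018, Ch. 3, Thm. 27] [cite: LMFDB, number field 3.1.4087.1 (class number 1)] -/
theorem isPrincipal_of_mem_primesOver_5 (h3 : finrank ℚ F = 3) (hα : aeval α (poly (-7) 18 8) = 0) {P : Ideal (𝓞 F)}
    (hP : P ∈ primesOver (span {((5 : ℕ) : ℤ)}) (𝓞 F))
    (hle : 5 ^ P.inertiaDeg ℤ ≤ 18) : Submodule.IsPrincipal P := by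
  haveI : Fact (Nat.Prime 5) := ⟨by norm_num⟩
  obtain ⟨Qb, hirr, hmon, hdvd, hdeg, hspan⟩ :=
    exists_factor_of_mem_primesOver' irreducible_polyQ hα (by norm_num : Nat.Prime 5)
      (not_dvd_exponent h3 hα (by norm_num) (by norm_num)) hP
  rw [polyMod_5] at hdvd
  rcases hirr.prime.dvd_or_dvd hdvd with h | h
  · have hirr1 : Irreducible (X + 4 : (ZMod 5)[X]) := by
      rw [show (X + 4 : (ZMod 5)[X]) = X - C (-4) by rw [map_neg, map_ofNat]; ring]
      exact irreducible_X_sub_C _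
    have hQb : Qb = X + 4 := eq_of_monic_of_associated hmon (by monicity!) (hirr.associated_of_dvd hirr1 h)
    have hPeq := hspan (X + C 4) (by rw [hQb]; simp [map_ofNat])
    rw [show aeval (thetaInt hα) (X + C 4 : ℤ[X]) = thetaInt hα + 4 by
        simp only [map_add, aeval_X, aeval_C, algebraMap_int_eq, Int.coe_castRingHom, Int.cast_ofNat], Nat.cast_ofNat, span_5_lin4_eq hα] at hPeq
    exact ⟨⟨1 + 2 * thetaInt hα + 2 * thetaInt (delta_root hα), by rw [hPeq, Ideal.submodule_span_eq]⟩⟩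
  · have hQb : Qb = X ^ 2 + 4 * X + 2 :=
      eq_of_monic_of_associated hmon (by monicity!) (hirr.associated_of_dvd irreducible_quad_5 h)
    exfalso
    have hd2 : (X ^ 2 + 4 * X + 2 : (ZMod 5)[X]).natDegree = 2 := by compute_degree!
    rw [hdeg, hQb, hd2] at hle
    norm_num at hle

end NumberField

end Literature.NumberTheory.CubicFields.CubicDisc4087

end
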